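import Literature.NumberTheory.Rogawski1990.U3SupercuspidalJacquetVanishing    -- ★ `coinvariants_subsingleton_of_isSupercuspidal`, `borelTriple`, `unipotentU`, `exists_torusU_family`, congruence cone
import Literature.NumberTheory.Automorphic.ParabolicInductionSupercuspidalProofs -- ★ `exists_pow_mul_le` (archimedean value group)
import Literature.NumberTheory.Automorphic.ReductionTheoryGLnConjugation        -- ★ `isClosed_upperUnitriangular`
import Mathlib.MeasureTheory.Integral.DominatedConvergence
import Mathlib.MeasureTheory.Group.Measure
import HarnessLib

/-!
# Matrix coefficients of supercuspidal representations of the quasi-split `U(3)` are supercusp forms: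
# `∫_N φ(ρ(a n b) w) dn = 0` along the unipotent radical `N` of the Borel subgroup

Topic `NumberTheory/Automorphic`; namespace `Literature.NumberTheory.Automorphic` (§1, generic) and `….UnitaryGroup` (§2–§3, the
model `U(σ, Φ₃)(K)` over a non-archimedean local field).  THEOREMS ONLY (no definition, no named fact, no instance, no notation,
no `sorry`).  Cell `pub/hodgecm-mathlib`, crux H413 = `stmt-HodgeConjecture-24833` (`--supports` lane, helper), LH6 ∕ rung-0 residue,
CENSUS «HC-SC» v1 (F0P3a-p02 (g26)) §2 brick **E2-3a «U3-CUSP-FORM»** (LEAD F0P3a-plan (g15) T14-62 (1) «GO-LOW»): the `U(3)` twin of the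
tree's PROVED `GL_n` statement ★ `Literature.NumberTheory.Automorphic.integral_matrixCoeff_unipotent_eq_zero`
(`SupercuspFormUnipotentIntegral.lean`).  HONEST LABEL: count-neutral, generic∕reusable (the vanishing of the `N`-integrals of cusp forms is the
input of the Selberg principle — census E2-3b — and of any simple trace formula on `U(3)` with a supercuspidal test function); HC_CM is proved only
modulo the 7 printed citations (2 remaining named inputs hLiu418 = stmt-HodgeConjecture-24832, h413 = stmt-HodgeConjecture-24833) until rung 0
closes.

THE MATHEMATICS [HarishChandra1970, Part I §3 («`f` is a supercusp form if `f^P = 0` for all `P ≠ G`»; Thm. 6∕Cor.: matrix coefficients of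
supercuspidal representations are supercusp forms); Casselman1995 Thm. 5.3.1; Rogawski1990 §1.10 p. 9 (`B = MN`), §12.2 p. 173].  Let `ρ` be a
SMOOTH representation of a topological group `G` on `V`, `N ≤ G` a subgroup with a right-invariant measure `μ` finite on compacta.
(§1, JACQUET'S FIRST LEMMA WITH A MEASURE) If `w ∈ V(N) = ⟨ρ(n)x − x⟩`, there is a finite set `S ⊆ N` such that `∫_{N′} φ(ρ(a n) w) dμ(n) = 0`
for every compact open SUBGROUP `N′ ⊇ S` of `N`, every linear form `φ` and every `a ∈ G`: for a generator `ρ(n₀)x − x` the two integrals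
`∫_{N′} φ(ρ(a n n₀)x)`, `∫_{N′} φ(ρ(a n)x)` agree by right-invariance (`N′ n₀ = N′`), and each converges because `n ↦ φ(ρ(a n)x)` is LOCALLY CONSTANT
(smoothness).  Hence, if `N` is exhausted by an increasing sequence of compact open subgroups, `∫_N φ(ρ(a n) w) dμ = 0` whenever the integral
converges absolutely (`tendsto_setIntegral_of_monotone`).  (§2) For the quasi-split `U = U(σ, Φ₃)(K)` over a non-archimedean local field `K`
(`σ` continuous, a `σ`-fixed `ϖ ≠ 0` with `|ϖ| < 1`) the unipotent radical `N` of the Borel subgroup (★ `unipotentU`, the Heisenberg group) IS so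
exhausted: with Rogawski's torus elements `a_j = d(ϖ^j, 1, ϖ^{-j})` (★ `exists_torusU_family`) and the principal congruence subgroup `K_γ ∩ U`,
`γ = |ϖ|`, the subgroups `N_j = {n ∈ N ∣ a_j n a_j⁻¹ ∈ K_γ}` are compact open, increasing (conjugation by `a_1` CONTRACTS `N`: the `(i, k)` entry
is multiplied by `ϖ^{k−i}`, ★ `coe_zpowDiagGL_mul_mul_inv_sub_one_apply`) and cover `N` (archimedean value group).  (§3) For `ρ` SUPERCUSPIDAL,
`V(N) = V` (★ `coinvariants_subsingleton_of_isSupercuspidal`, Casselman's Haar-free argument), so EVERY `∫_N φ(ρ(a n b) w) dn` that converges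
absolutely vanishes.

* §1 `isLocallyConstant_dual_apply_mul_subgroup`, `integrableOn_dual_apply_mul_of_isCompact`,
  **`exists_finset_forall_setIntegral_dual_apply_eq_zero_of_mem_span`**, **`integral_dual_apply_eq_zero_of_mem_span_of_exhaustion`** (generic).
* §2 **`UnitaryGroup.exists_compactOpen_subgroups_exhausting_unipotentU_three`** (the exhaustion of the Heisenberg `N`).
* §3 **`UnitaryGroup.integral_dual_apply_unipotentU_eq_zero_of_isSupercuspidal`** (the head).

## References
* [HarishChandra1970] Harish-Chandra (notes by G. van Dijk), *Harmonic Analysis on Reductive p-adic Groups*, LNM 162 (1970), Part I §3.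
* [Casselman1995] W. Casselman, *Introduction to the theory of admissible representations of p-adic reductive groups* (1995), Prop. 1.4.4, Thm. 5.3.1.
* [Rogawski1990] J. D. Rogawski, *Automorphic Representations of Unitary Groups in Three Variables*, Ann. of Math. Stud. 123 (1990), §1.10 p. 9; §12.2 p. 173.
* [Gelbart1975] S. Gelbart, *Automorphic forms on adele groups*, Ann. of Math. Stud. 83 (1975), Remark 9.23 p. 140.
-/

set_option autoImplicit false

noncomputable section

open MeasureTheory Measure Set Filter Topology
open scoped MatrixGroups Pointwise Topology

namespace Literature.NumberTheory.Automorphic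

/-! ## §1 Jacquet's first lemma against a right-invariant measure on a subgroup (generic) -/

section Generic

variable {G : Type*} [Group G] [TopologicalSpace G] [IsTopologicalGroup G]
  {V : Type*} [AddCommGroup V] [Module ℂ V] (ρ : Representation ℂ G V)
  (N : Subgroup G)

/-- For a smooth `ρ`, the coefficient `n ↦ φ(ρ(a n) x)` is LOCALLY CONSTANT on the subgroup `N` (it is constant on the cosets
`n · (Stab(x) ∩ N)`, and `Stab(x)` is open). [cite: HarishChandra1970, Part I §3] [cite: Casselman1995, Prop. 1.4.4] -/
theorem isLocallyConstant_dual_apply_mul_subgroup (hρ : ρ.IsSmooth) (φ : Module.Dual ℂ V) (a : G) (x : V) :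
    IsLocallyConstant (fun n : ↥N => φ (ρ (a * n) x)) := by
  refine (IsLocallyConstant.iff_exists_open _).2 fun n => ?_
  have hS : IsOpen (ρ.stabilizerSubgroup x : Set G) := hρ x
  refine ⟨{n' : ↥N | ((n : G)⁻¹ * (n' : G)) ∈ ρ.stabilizerSubgroup x}, ?_, ?_, ?_⟩
  · exact hS.preimage ((continuous_const.mul continuous_subtype_val))
  · simp only [mem_setOf_eq, inv_mul_cancel, Subgroup.one_mem]
  · intro n' hn'
    rw [mem_setOf_eq, Representation.mem_stabilizerSubgroup] at hn'
    show φ (ρ (a * n') x) = φ (ρ (a * n) x)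
    have h : ρ (a * (n' : G)) x = ρ (a * (n : G)) (ρ ((n : G)⁻¹ * (n' : G)) x) := by
      rw [← Module.End.mul_apply, ← map_mul]
      congr 2
      group
    rw [h, hn']

variable [T2Space G] [MeasurableSpace ↥N] [BorelSpace ↥N] (μ : Measure ↥N)

/-- For a smooth `ρ`, `n ↦ φ(ρ(a n) x)` is integrable on every compact subset of `N` against a measure finite on compacta.
[cite: HarishChandra1970, Part I §3] -/
theorem integrableOn_dual_apply_mul_of_isCompact [IsFiniteMeasureOnCompacts μ] (hρ : ρ.IsSmooth) (φ : Module.Dual ℂ V) (a : G)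
    (x : V) {S : Set ↥N} (hS : IsCompact S) :
    IntegrableOn (fun n : ↥N => φ (ρ (a * n) x)) S μ :=
  (isLocallyConstant_dual_apply_mul_subgroup ρ N hρ φ a x).continuous.continuousOn.integrableOn_compact hS

/-- **JACQUET'S FIRST LEMMA WITH A RIGHT-INVARIANT MEASURE.**  If `w ∈ V(N) = ⟨ρ(n)x − x : n ∈ N, x ∈ V⟩`, there is a finite set `S ⊆ N`
such that for every compact open subgroup `N′` of `N` containing `S`, every linear form `φ` and every `a ∈ G`:
`∫_{N′} φ(ρ(a n) w) dμ(n) = 0`.  (For a generator `ρ(n₀)x − x`: `S = {n₀}`, and `∫_{N′} φ(ρ(a n n₀) x) = ∫_{N′} φ(ρ(a n) x)` by right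
invariance, `N′ n₀ = N′`.) [cite: HarishChandra1970, Part I §3] [cite: Casselman1995, Thm. 5.3.1] -/
theorem exists_finset_forall_setIntegral_dual_apply_eq_zero_of_mem_span [IsFiniteMeasureOnCompacts μ] [μ.IsMulRightInvariant]
    (hρ : ρ.IsSmooth) {w : V}
    (hw : w ∈ Submodule.span ℂ (Set.range fun p : ↥N × V => ρ (p.1 : G) p.2 - p.2)) :
    ∃ S : Finset ↥N, ∀ N' : Subgroup ↥N, (↑S : Set ↥N) ⊆ (N' : Set ↥N) → IsCompact (N' : Set ↥N) → IsOpen (N' : Set ↥N) →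
      ∀ (φ : Module.Dual ℂ V) (a : G), ∫ n in (N' : Set ↥N), φ (ρ (a * n) w) ∂μ = 0 := by
  classical
  induction hw using Submodule.span_induction with
  | mem x hx =>
    obtain ⟨⟨n₀, x⟩, rfl⟩ := hx
    refine ⟨{n₀}, fun N' hS hc ho φ a => ?_⟩
    have hn₀ : n₀ ∈ N' := by
      have : n₀ ∈ (↑({n₀} : Finset ↥N) : Set ↥N) := by simp
      exact hS this
    have hint := integrableOn_dual_apply_mul_of_isCompact ρ N μ hρ φ a x hc
    have h1 : ∀ n : ↥N, φ (ρ (a * n) (ρ (n₀ : G) x - x)) = φ (ρ (a * (n * n₀ : ↥N)) x) - φ (ρ (a * n) x) := fun n => by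
      rw [map_sub, map_sub, ← Module.End.mul_apply, ← map_mul, Subgroup.coe_mul, mul_assoc]
    simp_rw [h1]
    have hint' : IntegrableOn (fun n : ↥N => φ (ρ (a * (n * n₀ : ↥N)) x)) (N' : Set ↥N) μ := by
      have h := integrableOn_dual_apply_mul_of_isCompact ρ N μ hρ (φ ∘ₗ ρ a) (1 : G) (ρ (n₀ : G) x) hc
      refine h.congr_fun (fun n _ => ?_) ho.measurableSet
      simp only [LinearMap.coe_comp, Function.comp_apply, one_mul, Subgroup.coe_mul, ← Module.End.mul_apply, ← map_mul]
    rw [integral_sub hint' hint, sub_eq_zero]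
    -- right translation by `n₀ ∈ N′` preserves `N′` and `μ`
    have hind : ∀ n : ↥N, (N' : Set ↥N).indicator (fun n : ↥N => φ (ρ (a * (n * n₀ : ↥N)) x)) n =
        (N' : Set ↥N).indicator (fun n : ↥N => φ (ρ (a * n) x)) (n * n₀) := by
      intro n
      by_cases hn : n ∈ (N' : Set ↥N)
      · rw [indicator_of_mem hn, indicator_of_mem (show n * n₀ ∈ (N' : Set ↥N) from N'.mul_mem hn hn₀)]
      · have hn' : n * n₀ ∉ (N' : Set ↥N) := fun h => hn (by
          have := N'.mul_mem h (N'.inv_mem hn₀)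
          rwa [mul_inv_cancel_right] at this)
        rw [indicator_of_notMem hn, indicator_of_notMem hn']
    rw [← integral_indicator ho.measurableSet, ← integral_indicator ho.measurableSet]
    simp_rw [hind]
    exact integral_mul_right_eq_self (fun n : ↥N => (N' : Set ↥N).indicator (fun n : ↥N => φ (ρ (a * n) x)) n) n₀
  | zero => exact ⟨∅, fun N' _ _ _ φ a => by simp⟩
  | add x y _ _ hx hy =>
    obtain ⟨S₁, h₁⟩ := hx
    obtain ⟨S₂, h₂⟩ := hy
    refine ⟨S₁ ∪ S₂, fun N' hS hc ho φ a => ?_⟩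
    have hS₁ : (↑S₁ : Set ↥N) ⊆ N' := fun n hn => hS (by simp [Finset.mem_coe.1 hn])
    have hS₂ : (↑S₂ : Set ↥N) ⊆ N' := fun n hn => hS (by simp [Finset.mem_coe.1 hn])
    have e1 : ∀ n : ↥N, φ (ρ (a * n) (x + y)) = φ (ρ (a * n) x) + φ (ρ (a * n) y) := fun n => by rw [map_add, map_add]
    simp_rw [e1]
    rw [integral_add (integrableOn_dual_apply_mul_of_isCompact ρ N μ hρ φ a x hc)
      (integrableOn_dual_apply_mul_of_isCompact ρ N μ hρ φ a y hc), h₁ N' hS₁ hc ho φ a, h₂ N' hS₂ hc ho φ a, add_zero]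
  | smul r x _ hx =>
    obtain ⟨S₁, h₁⟩ := hx
    refine ⟨S₁, fun N' hS hc ho φ a => ?_⟩
    have e1 : ∀ n : ↥N, φ (ρ (a * n) (r • x)) = r * φ (ρ (a * n) x) := fun n => by rw [map_smul, map_smul, smul_eq_mul]
    simp_rw [e1]
    rw [integral_const_mul, h₁ N' hS hc ho φ a, mul_zero]

/-- **`∫_N φ(ρ(a n) w) dμ = 0` for `w ∈ V(N)` whenever the integral converges absolutely**, provided `N` is exhausted by an increasing
sequence of compact open subgroups: the integrals over them vanish eventually (Jacquet's first lemma) and tend to the full integral.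
[cite: HarishChandra1970, Part I §3] [cite: Casselman1995, Thm. 5.3.1] -/
theorem integral_dual_apply_eq_zero_of_mem_span_of_exhaustion [IsFiniteMeasureOnCompacts μ] [μ.IsMulRightInvariant]
    (hρ : ρ.IsSmooth) {w : V}
    (hw : w ∈ Submodule.span ℂ (Set.range fun p : ↥N × V => ρ (p.1 : G) p.2 - p.2))
    (Nj : ℕ → Subgroup ↥N) (hmono : Monotone Nj) (hc : ∀ j, IsCompact (Nj j : Set ↥N)) (ho : ∀ j, IsOpen (Nj j : Set ↥N))
    (hex : ∀ n : ↥N, ∃ j, n ∈ Nj j) (φ : Module.Dual ℂ V) (a : G)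
    (hi : Integrable (fun n : ↥N => φ (ρ (a * n) w)) μ) :
    ∫ n : ↥N, φ (ρ (a * n) w) ∂μ = 0 := by
  obtain ⟨S, hS⟩ := exists_finset_forall_setIntegral_dual_apply_eq_zero_of_mem_span ρ N μ hρ hw
  -- an index `j₀` with `S ⊆ N_{j₀}`
  have hfin : ∀ T : Finset ↥N, ∃ j₀, (↑T : Set ↥N) ⊆ (Nj j₀ : Set ↥N) := by
    classical
    intro T
    induction T using Finset.induction_on with
    | empty => exact ⟨0, by simp⟩
    | insert n T hn ih =>
      obtain ⟨j₁, hj₁⟩ := ih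
      obtain ⟨j₂, hj₂⟩ := hex n
      refine ⟨max j₁ j₂, ?_⟩
      intro m hm
      rcases Finset.mem_insert.1 (Finset.mem_coe.1 hm) with rfl | hm'
      · exact hmono (le_max_right _ _) hj₂
      · exact hmono (le_max_left _ _) (hj₁ (Finset.mem_coe.2 hm'))
  obtain ⟨j₀, hj₀⟩ := hfin S
  have hmono' : Monotone fun j => (Nj j : Set ↥N) := fun i j hij => hmono hij
  have hcover : (⋃ j, (Nj j : Set ↥N)) = univ := eq_univ_of_forall fun n => by
    obtain ⟨j, hj⟩ := hex n
    exact mem_iUnion.2 ⟨j, hj⟩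
  have htend : Tendsto (fun j => ∫ n in (Nj j : Set ↥N), φ (ρ (a * n) w) ∂μ) atTop (𝓝 (∫ n, φ (ρ (a * n) w) ∂μ)) := by
    have h := tendsto_setIntegral_of_monotone (μ := μ) (fun j => (ho j).measurableSet) hmono' (by rw [hcover]; exact hi.integrableOn)
    rwa [hcover, Measure.restrict_univ] at h
  have hev : ∀ᶠ j in atTop, ∫ n in (Nj j : Set ↥N), φ (ρ (a * n) w) ∂μ = 0 :=
    eventually_atTop.2 ⟨j₀, fun j hj => hS (Nj j) (hj₀.trans (hmono hj)) (hc j) (ho j) φ a⟩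
  exact tendsto_nhds_unique htend (tendsto_const_nhds.congr' (hev.mono fun j hj => hj.symm))

end Generic

/-! ## §2 The unipotent radical of the Borel subgroup of `U(σ, Φ₃)(K)` is exhausted by compact open subgroups -/

namespace UnitaryGroup

section Model

open ValuativeRel Matrix

variable {K : Type*} [Field K] [ValuativeRel K] [TopologicalSpace K] [IsNonarchimedeanLocalField K]
  (σ : K →+* K) {J : Matrix (Fin 3) (Fin 3) K}

omit [TopologicalSpace K] [IsNonarchimedeanLocalField K] in
/-- **Conjugation by Rogawski's torus element `a_j = d(ϖ^j, 1, ϖ^{-j})` CONTRACTS the upper unitriangular matrices**: if `g` is upper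
unitriangular with `|(g − 1)_{ik}| ≤ δ`, then `|(a_j g a_j⁻¹ − 1)_{ik}| ≤ |ϖ|^j δ` (the `(i, k)` entry is multiplied by `ϖ^{j(k−i)}`, `k > i` above the
diagonal; `|ϖ| ≤ 1`). [cite: Casselman1995, Prop. 1.4.4] [cite: Rogawski1990, §1.10 p. 9] -/
theorem valBound_torusConj_sub_one_of_unitriangular {ϖ : K} (hϖ0 : ϖ ≠ 0) (hϖ1 : valuation K ϖ ≤ 1)
    {g : GL (Fin 3) K} (hut : (g : Matrix (Fin 3) (Fin 3) K).BlockTriangular id) (hdiag : ∀ i, (g : Matrix (Fin 3) (Fin 3) K) i i = 1)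
    {δ : ValueGroupWithZero K} (hδ : ValBound δ ((g : Matrix (Fin 3) (Fin 3) K) - 1)) (j : ℕ) :
    ValBound (valuation K ϖ ^ j * δ)
      (((zpowDiagGL hϖ0 (fun i : Fin 3 => (j : ℤ) * (1 - (i.val : ℤ))) * g *
          (zpowDiagGL hϖ0 (fun i : Fin 3 => (j : ℤ) * (1 - (i.val : ℤ))))⁻¹ : GL (Fin 3) K) : Matrix (Fin 3) (Fin 3) K) - 1) := by
  intro i k
  rw [coe_zpowDiagGL_mul_mul_inv_sub_one_apply, map_mul, map_zpow₀]
  rcases lt_trichotomy i k with hik | rfl | hki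
  · -- above the diagonal: the exponent is `j (k - i)` with `k - i ≥ 1`
    have hik' : i.val < k.val := hik
    have hexp : (j : ℤ) * (1 - (i.val : ℤ)) - (j : ℤ) * (1 - (k.val : ℤ)) = ((j * (k.val - i.val) : ℕ) : ℤ) := by
      rw [Nat.cast_mul, Nat.cast_sub hik'.le]
      ring
    rw [hexp, zpow_natCast]
    have hle : valuation K ϖ ^ (j * (k.val - i.val)) ≤ valuation K ϖ ^ j := by
      have h1 : 1 ≤ k.val - i.val := by omega
      calc valuation K ϖ ^ (j * (k.val - i.val)) ≤ valuation K ϖ ^ (j * 1) :=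
            pow_le_pow_right_of_le_one' hϖ1 (Nat.mul_le_mul_left j h1)
        _ = valuation K ϖ ^ j := by rw [mul_one]
    exact mul_le_mul' hle (hδ i k)
  · -- on the diagonal `(g - 1)_{ii} = 0`
    have h0 : ((g : Matrix (Fin 3) (Fin 3) K) - 1) i i = 0 := by
      rw [Matrix.sub_apply, hdiag i, Matrix.one_apply_eq, sub_self]
    rw [h0, map_zero, mul_zero]
    exact zero_le
  · -- below the diagonal `g_{ik} = 0 = 1_{ik}`
    have h0 : ((g : Matrix (Fin 3) (Fin 3) K) - 1) i k = 0 := by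
      rw [Matrix.sub_apply, hut hki, Matrix.one_apply_ne (ne_of_gt hki), sub_zero]
    rw [h0, map_zero, mul_zero]
    exact zero_le

/-- **THE HEISENBERG GROUP `N ≤ U(σ, Φ₃)(K)` IS AN INCREASING UNION OF COMPACT OPEN SUBGROUPS.**  For `σ` continuous and a `σ`-fixed `ϖ ≠ 0`
with `|ϖ| < 1`: `N_j = {n ∈ N ∣ a_j n a_j⁻¹ ∈ K_{|ϖ|}}`, `a_j = d(ϖ^j, 1, ϖ^{-j})` [Rogawski1990, §1.10 p. 9], `K_γ` the principal congruence
subgroup of `GL₃`, is a compact open subgroup of `N`; `N_j ⊆ N_{j+1}` because conjugation by `a_1` contracts; and every `n ∈ N` lies in some `N_j`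
(archimedean value group). [cite: Casselman1995, Prop. 1.4.4] [cite: Rogawski1990, §1.10 p. 9] -/
theorem exists_compactOpen_subgroups_exhausting_unipotentU_three (hJ : J = (StdForm.antidiagonal 3).over K) (hσc : Continuous σ)
    {ϖ : K} (hϖ0 : ϖ ≠ 0) (hϖ1 : valuation K ϖ < 1) (hσϖ : σ ϖ = ϖ) :
    ∃ Nj : ℕ → Subgroup ↥(unipotentU σ J), Monotone Nj ∧ (∀ j, IsCompact (Nj j : Set ↥(unipotentU σ J))) ∧
      (∀ j, IsOpen (Nj j : Set ↥(unipotentU σ J))) ∧ ∀ n : ↥(unipotentU σ J), ∃ j, n ∈ Nj j := by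
  haveI : T2Space K := (Literature.NumberTheory.GaloisRepresentations.IsNonarchimedeanLocalField.isLocalField K).toT2Space
  obtain ⟨a, ha, -, -, haM, -⟩ := exists_torusU_family σ hJ hϖ0 hσϖ
  -- the torus normalises `N`
  have hnorm : ∀ {t : ↥(unitaryGroupOfForm σ J)}, t ∈ torusU σ J → ∀ u : ↥(unitaryGroupOfForm σ J), u ∈ unipotentU σ J →
      t * u * t⁻¹ ∈ unipotentU σ J := fun ht u hu => by
    have h := (borelU_le_normalizer σ J) (torusU_le_borelU σ J ht)
    rw [Subgroup.mem_normalizer_iff] at h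
    exact (h u).1 hu
  have haT : ∀ j, a j ∈ torusU σ J := fun j => haM j
  have hγ0 : valuation K ϖ ≠ 0 := (Valuation.ne_zero_iff _).2 hϖ0
  -- the principal congruence subgroup `K_γ ∩ U`, `γ = |ϖ|`
  set Kγ : Subgroup ↥(unitaryGroupOfForm σ J) := (congruenceGL 3 (valuation K ϖ)).comap (unitaryGroupOfForm σ J).subtype with hKγ
  obtain ⟨hKc, hKo⟩ := isCompact_isOpen_comap_congruenceGL σ (J := J) hσc hγ0
  -- the conjugation maps `c_j : N → U`, `n ↦ a_j n a_j⁻¹`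
  set c : ℕ → (↥(unipotentU σ J) →* ↥(unitaryGroupOfForm σ J)) := fun j =>
    (MulAut.conj (a j)).toMonoidHom.comp (unipotentU σ J).subtype with hc
  have hc_apply : ∀ j (n : ↥(unipotentU σ J)), c j n = a j * n * (a j)⁻¹ := fun j n => rfl
  have hc_cont : ∀ j, Continuous (c j) := fun j =>
    ((continuous_const.mul continuous_subtype_val).mul continuous_const)
  -- the key computation: `a_j n a_j⁻¹ ∈ K_γ` as soon as `|ϖ|^j · sup |(n - 1)_{ik}| ≤ γ`
  have hkey : ∀ (j : ℕ) (n : ↥(unitaryGroupOfForm σ J)), n ∈ unipotentU σ J → ∀ δ : ValueGroupWithZero K,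
      ValBound δ (((n : GL (Fin 3) K) : Matrix (Fin 3) (Fin 3) K) - 1) → valuation K ϖ ^ j * δ ≤ valuation K ϖ →
      ((a j * n * (a j)⁻¹ : ↥(unitaryGroupOfForm σ J)) : GL (Fin 3) K) ∈ congruenceGL 3 (valuation K ϖ) := by
    intro j n hn δ hδ hle
    obtain ⟨hut, hdiag⟩ := (mem_unipotentU_iff _).1 hn
    rw [Subgroup.coe_mul, Subgroup.coe_mul, Subgroup.coe_inv, ha]
    exact mem_congruenceGL_of_valBound_sub_one hϖ1
      ((valBound_torusConj_sub_one_of_unitriangular hϖ0 hϖ1.le hut hdiag hδ j).mono hle)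
  refine ⟨fun j => Kγ.comap (c j), ?_, ?_, ?_, ?_⟩
  · -- monotone: `a_{j+1} n a_{j+1}⁻¹ = a_1 (a_j n a_j⁻¹) a_1⁻¹`, and `a_j n a_j⁻¹ ∈ N ∩ K_γ`
    refine monotone_nat_of_le_succ fun j n hn => ?_
    rw [Subgroup.mem_comap] at hn ⊢
    rw [Subgroup.mem_comap] at hn ⊢
    have hcomm : a (j + 1) = a 1 * a j := by
      apply Subtype.ext
      rw [Subgroup.coe_mul, ha, ha, ha, ← zpowDiagGL_add]
      congr 1
      funext i
      simp only [Pi.add_apply]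
      push_cast
      ring
    have hconj : (c (j + 1) n : ↥(unitaryGroupOfForm σ J)) = a 1 * (c j n) * (a 1)⁻¹ := by
      rw [hc_apply, hc_apply, hcomm, mul_inv_rev]
      group
    have hmN : (c j n : ↥(unitaryGroupOfForm σ J)) ∈ unipotentU σ J := by
      rw [hc_apply]
      exact hnorm (haT j) n n.2
    have hmK : ((c j n : ↥(unitaryGroupOfForm σ J)) : GL (Fin 3) K) ∈ congruenceGL 3 (valuation K ϖ) := hn
    show ((c (j + 1) n : ↥(unitaryGroupOfForm σ J)) : GL (Fin 3) K) ∈ congruenceGL 3 (valuation K ϖ)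
    rw [hconj]
    refine hkey 1 (c j n) hmN (valuation K ϖ) (mem_congruenceGL_iff.1 hmK).2.1 ?_
    rw [pow_one]
    exact mul_le_of_le_one_left' hϖ1.le
  · -- compact: `N_j` is the image of the compact `N ∩ K_γ` under the homeomorphism `m ↦ a_j⁻¹ m a_j` of `N`
    intro j
    have hNcl : IsClosed (unipotentU σ J : Set ↥(unitaryGroupOfForm σ J)) :=
      (isClosed_upperUnitriangular (n := 3) (R := K)).preimage continuous_subtype_val
    have hemb : Topology.IsClosedEmbedding (Subtype.val : ↥(unipotentU σ J) → ↥(unitaryGroupOfForm σ J)) :=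
      hNcl.isClosedEmbedding_subtypeVal
    have hC : IsCompact ((Subtype.val : ↥(unipotentU σ J) → ↥(unitaryGroupOfForm σ J)) ⁻¹' (Kγ : Set ↥(unitaryGroupOfForm σ J))) :=
      hemb.isCompact_preimage hKc
    have hinvN : ∀ m : ↥(unipotentU σ J), (a j)⁻¹ * (m : ↥(unitaryGroupOfForm σ J)) * a j ∈ unipotentU σ J := fun m => by
      simpa only [inv_inv] using hnorm (inv_mem (haT j)) m m.2
    set d : ↥(unipotentU σ J) → ↥(unipotentU σ J) := fun m => ⟨(a j)⁻¹ * (m : ↥(unitaryGroupOfForm σ J)) * a j, hinvN m⟩ with hd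
    have hdc : Continuous d :=
      Continuous.subtype_mk ((continuous_const.mul continuous_subtype_val).mul continuous_const) _
    have heq : (Kγ.comap (c j) : Set ↥(unipotentU σ J)) =
        d '' ((Subtype.val : ↥(unipotentU σ J) → ↥(unitaryGroupOfForm σ J)) ⁻¹' (Kγ : Set ↥(unitaryGroupOfForm σ J))) := by
      ext n
      simp only [SetLike.mem_coe, Subgroup.mem_comap, mem_image, mem_preimage]
      constructor
      · intro hn
        refine ⟨⟨c j n, hnorm (haT j) n n.2⟩, hn, ?_⟩
        apply Subtype.ext
        show (a j)⁻¹ * (a j * n * (a j)⁻¹) * a j = n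
        group
      · rintro ⟨m, hm, rfl⟩
        have : c j (d m) = (m : ↥(unitaryGroupOfForm σ J)) := by
          rw [hc_apply]
          show a j * ((a j)⁻¹ * (m : ↥(unitaryGroupOfForm σ J)) * a j) * (a j)⁻¹ = m
          group
        rw [this]
        exact hm
    rw [heq]
    exact hC.image hdc
  · -- open: preimage of the open `K_γ ∩ U` under the continuous conjugation
    intro j
    exact hKo.preimage (hc_cont j)
  · -- exhaustion: `|ϖ|^j · sup |(n - 1)_{ik}| ≤ γ` for `j` large (archimedean value group)
    intro n
    obtain ⟨j, hj⟩ := exists_pow_mul_le hγ0 hϖ1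
      (Finset.univ.sup fun p : Fin 3 × Fin 3 =>
        valuation K (((((n : ↥(unitaryGroupOfForm σ J)) : GL (Fin 3) K) : Matrix (Fin 3) (Fin 3) K) - 1) p.1 p.2)) hγ0
    refine ⟨j, ?_⟩
    rw [Subgroup.mem_comap]
    rw [Subgroup.mem_comap]
    show ((c j n : ↥(unitaryGroupOfForm σ J)) : GL (Fin 3) K) ∈ congruenceGL 3 (valuation K ϖ)
    rw [hc_apply]
    refine hkey j n n.2 _ (fun i k => ?_) hj
    exact Finset.le_sup (f := fun p : Fin 3 × Fin 3 =>
      valuation K (((((n : ↥(unitaryGroupOfForm σ J)) : GL (Fin 3) K) : Matrix (Fin 3) (Fin 3) K) - 1) p.1 p.2)) (Finset.mem_univ (i, k))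

/-! ## §3 The head: `N`-integrals of matrix coefficients of supercuspidal representations of `U(σ, Φ₃)(K)` vanish -/

/-- **MATRIX COEFFICIENTS OF SUPERCUSPIDAL REPRESENTATIONS OF THE QUASI-SPLIT `U(3)` ARE SUPERCUSP FORMS.**  Let `K` be a non-archimedean
local field with a continuous ring endomorphism `σ`, `J = Φ₃`, `U = U(σ, Φ₃)(K)` with SCALAR centre, `ϖ ≠ 0` a `σ`-fixed element with
`|ϖ| < 1`, `N ≤ U` the unipotent radical of the Borel subgroup (★ `unipotentU`, Rogawski's `N = {u(x, z)}`) with a right-invariant Borel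
measure `μ` finite on compacta (e.g. a Haar measure: `N` is unimodular).  For every SMOOTH SUPERCUSPIDAL representation `ρ` of `U` (★
`Representation.IsSupercuspidal`), every linear form `φ`, vector `w` and `a, b ∈ U`: if `n ↦ φ(ρ(a n b) w)` is integrable on `N`, then
`∫_N φ(ρ(a n b) w) dμ(n) = 0` — `V = V(N)` by Harish-Chandra's criterion (★ `coinvariants_subsingleton_of_isSupercuspidal`), and §1–§2.
[cite: HarishChandra1970, Part I §3] [cite: Casselman1995, Thm. 5.3.1] [cite: Rogawski1990, §12.2 p. 173] [cite: Gelbart1975, Remark 9.23] -/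
theorem integral_dual_apply_unipotentU_eq_zero_of_isSupercuspidal (hJ : J = (StdForm.antidiagonal 3).over K) (hσc : Continuous σ)
    (hZ : ∀ z ∈ Subgroup.center ↥(unitaryGroupOfForm σ J), ∃ u : Kˣ,
      ((z : ↥(unitaryGroupOfForm σ J)) : GL (Fin 3) K) = Matrix.GeneralLinearGroup.scalar (Fin 3) u)
    {ϖ : K} (hϖ0 : ϖ ≠ 0) (hϖ1 : valuation K ϖ < 1) (hσϖ : σ ϖ = ϖ)
    {V : Type*} [AddCommGroup V] [Module ℂ V]
    (ρ : Representation ℂ ↥(unitaryGroupOfForm σ J) V) (hρ : ρ.IsSmooth) (hsc : ρ.IsSupercuspidal)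
    [MeasurableSpace ↥(unipotentU σ J)] [BorelSpace ↥(unipotentU σ J)]
    (μ : Measure ↥(unipotentU σ J)) [IsFiniteMeasureOnCompacts μ] [μ.IsMulRightInvariant]
    (φ : Module.Dual ℂ V) (w : V) (a b : ↥(unitaryGroupOfForm σ J))
    (hi : Integrable (fun n : ↥(unipotentU σ J) => φ (ρ (a * n * b) w)) μ) :
    ∫ n : ↥(unipotentU σ J), φ (ρ (a * n * b) w) ∂μ = 0 := by
  haveI : T2Space K := (Literature.NumberTheory.GaloisRepresentations.IsNonarchimedeanLocalField.isLocalField K).toT2Space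
  -- `V = V(N)`: the Jacquet module along the Borel vanishes
  haveI hsub := coinvariants_subsingleton_of_isSupercuspidal σ hJ hσc hZ hϖ0 hϖ1 hσϖ ρ hρ hsc
  have hker : ρ b w ∈ Submodule.span ℂ (Set.range fun p : ↥(unipotentU σ J) × V => ρ (p.1 : ↥(unitaryGroupOfForm σ J)) p.2 - p.2) := by
    have h0 : Representation.Coinvariants.mk ((borelTriple σ J hJ).restrict ρ) (ρ b w) = 0 := Subsingleton.elim _ _
    rw [Representation.Coinvariants.mk_eq_zero] at h0
    -- the generators of `ker (restrict ρ)` are among ours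
    refine (Submodule.span_le.2 ?_) h0
    rintro _ ⟨⟨q, x⟩, rfl⟩
    refine Submodule.subset_span ⟨(⟨((q : ↥(borelTriple σ J hJ).P) : ↥(unitaryGroupOfForm σ J)), Subgroup.mem_subgroupOf.1 q.2⟩, x), ?_⟩
    rfl
  obtain ⟨Nj, hmono, hc, ho, hex⟩ := exists_compactOpen_subgroups_exhausting_unipotentU_three σ hJ hσc hϖ0 hϖ1 hσϖ
  have e1 : ∀ n : ↥(unipotentU σ J), φ (ρ (a * n * b) w) = φ (ρ (a * n) (ρ b w)) := fun n => by
    rw [map_mul, Module.End.mul_apply]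
  simp_rw [e1] at hi ⊢
  exact integral_dual_apply_eq_zero_of_mem_span_of_exhaustion ρ (unipotentU σ J) μ hρ hker Nj hmono hc ho hex φ a hi

end Model

end UnitaryGroup

end Literature.NumberTheory.Automorphic

end
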